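import Summits.AtomisticToContinuum.Crystallization.Theorems.PricedLinkCensusStackingHingeLjDominationTail
import Summits.AtomisticToContinuum.Crystallization.Theorems.PricedLinkCensusStackingHingeLjSummable

/-!
# `PricedLinkCensus.StackingHinge` (stmt-AtomisticToContinuum-14993), line `Sketch`: stub `stub_ljDomination`

Conjunct 3 of item 3063 (`PoissonBesselStacking.LjRegistryDomination`), the **Hägg half-domination** of the
Lennard-Jones interlayer registry couplings `J_k(a, h) = barlowCoupling lennardJones a h k` on the box
`B = {47/50 ≤ a ≤ 1, 39a/50 ≤ h ≤ 17a/20}`: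

  `Σ_{k ≥ 3} (k - 1) |J_k(a, h)| ≤ |J₂(a, h)| / 2`.

Proof (certified numerics, helpers `…LjDominationDual`, `…LjDominationTail`).  Reindex `J_k(a, h) = D_a(k h)`,
`D_a(H) = barlowCoupling lennardJones a H 1` (`ljd_barlowCoupling_eq`, via `…LjSummable`).  By `LayeredHull.stub_registry`, `D_a ≤ 0`
and `D_a` is non-decreasing on `H ≥ 39a/25`, so `|J₂| = -D_a(2h) ≥ -D_a(17a/10) ≥ R/(12a⁶)`, `R = 1797/10⁷`
(`stub_ljdJ2Lower`: the `m = 1` one-point certificate of the Bernstein representation), and for `k ≥ 3`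
`|J_k| = -D_a(kh) ≤ (1/(12a⁶)) ∫_0^∞ G(u) u² e^{-u (k h/a)²} du ≤ (C_F/(12a⁶)) ρ^k` with `ρ = 9/2500`,
`C_F ≈ 363.3` (`ljd_negD_le`, `ljd_scale`, `ljd_Fk_le`: the dual-side bound `G(u) ≤ (38/u) e^{-13.159/u}` and
`13.159/u + (kc)² u ≥ 2 · 2.829 k c/(39/50)`).  Summing, `Σ_{k ≥ 3} (k - 1) ρ^k = ρ³ (ρ/(1-ρ)² + 2/(1-ρ))` and
`C_F ρ³ (ρ/(1-ρ)² + 2/(1-ρ)) ≈ 3.41·10⁻⁵ ≤ R/2 ≈ 8.98·10⁻⁵`.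
-/

noncomputable section

namespace Summit.AtomisticToContinuum.Crystallization.Theorems.PricedHcpWindowsLjDomination

open MeasureTheory Set Real Filter Module
open scoped BigOperators Nat
open Literature.MathematicalPhysics.StatisticalMechanics Literature.Algebra.EuclideanLattices
open Summit.AtomisticToContinuum.Crystallization.Theorems.LayeredHull
open Summit.AtomisticToContinuum.Crystallization.Theorems.PricedHcpWindowsLjSummable

/-! ## Reindexing: layer distance `k` at spacing `h` is layer distance `1` at spacing `k h` -/

/-- **`J_k(a, h) = D_a(k h)`**: `barlowCoupling V a h k = barlowCoupling V a (k h) 1` (from the landed reindexing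
`PricedHcpWindowsLjSummable.ljs_barlowCoupling_eq` of the layer sums). [folklore] -/
theorem ljd_barlowCoupling_eq (V : ℝ → ℝ) (a h : ℝ) (k : ℕ) :
    barlowCoupling V a h k = barlowCoupling V a ((k : ℝ) * h) 1 := by
  rw [ljs_barlowCoupling_eq V a h k, ljs_barlowCoupling_eq V a ((k : ℝ) * h) 1, Nat.cast_one, one_mul]

/-! ## The stub -/

/-- **stub_ljDomination** (conjunct 3 of item 3063, the Hägg half-domination).  On the box `47/50 ≤ a ≤ 1`,
`39a/50 ≤ h ≤ 17a/20` the Lennard-Jones interlayer registry couplings satisfy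
`Σ_{k ≥ 3} (k - 1) |J_k(a, h)| ≤ |J₂(a, h)| / 2`.  Certified chain: `|J₂| ≥ R/(12a⁶)` with `R = 1797/10⁷`
(`stub_ljdJ2Lower` + monotonicity of `D_a` from `LayeredHull.stub_registry`), `|J_k| ≤ (C_F/(12a⁶)) ρ^k` for `k ≥ 3`
with `ρ = 9/2500` (`ljd_negD_le`, `ljd_scale`, `ljd_Fk_le`), and `C_F Σ_{k≥3}(k-1)ρ^k ≤ R/2` by `norm_num`.
[folklore] -/
theorem stub_ljDomination : ∀ a h : ℝ, 47 / 50 ≤ a → a ≤ 1 → 39 / 50 * a ≤ h → h ≤ 17 / 20 * a → ∑' k : ℕ, (if 3 ≤ k then ((k : ℝ) - 1) * |Literature.MathematicalPhysics.StatisticalMechanics.barlowCoupling Literature.MathematicalPhysics.StatisticalMechanics.lennardJones a h k| else 0) ≤ (1 / 2) * |Literature.MathematicalPhysics.StatisticalMechanics.barlowCoupling Literature.MathematicalPhysics.StatisticalMechanics.lennardJones a h 2| := by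
  intro a h ha ha1 hh hh1
  have ha0 : 0 < a := by linarith
  have hh0 : 0 < h := by linarith
  obtain ⟨_, -, hreg⟩ := stub_registry
  have hmono := (hreg a ha ha1).1
  set c : ℝ := h / a with hc
  have hc0 : 39 / 50 ≤ c := by rw [hc, le_div_iff₀ ha0]; linarith
  have hca : ∀ k : ℕ, (k : ℝ) * h / a = k * c := fun k => by rw [hc]; ring
  set R : ℝ := 1797 / 10000000 with hR
  set CF : ℝ := (87 / 20 : ℝ) ^ 2 * (19 + 1 / (13689 / 2500 - 2 / (87 / 20))) with hCF
  set ρ : ℝ := 9 / 2500 with hρ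
  have ha6 : 0 < 12 * a ^ 6 := by positivity
  -- `|J₂| ≥ R/(12 a⁶)`
  have hJ2 : R / (12 * a ^ 6) ≤ |barlowCoupling lennardJones a h 2| := by
    have h2 := ljd_barlowCoupling_eq lennardJones a h 2
    push_cast at h2
    have hm := (hmono (2 * h) (17 / 10 * a) (by linarith) (by linarith)).2
    have hl := stub_ljdJ2Lower a ha
    have hR0 : 0 ≤ R / (12 * a ^ 6) := by positivity
    rw [h2, abs_of_nonpos (by linarith)]
    linarith
  -- `(k - 1)|J_k| ≤ (k - 1) (C_F/(12 a⁶)) ρ^k` for `k ≥ 3`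
  have hk : ∀ k : ℕ, 3 ≤ k → ((k : ℝ) - 1) * |barlowCoupling lennardJones a h k| ≤
      ((k : ℝ) - 1) * (CF / (12 * a ^ 6) * ρ ^ k) := by
    intro k hk3
    have hk3' : (3 : ℝ) ≤ k := by exact_mod_cast hk3
    have hH : 39 / 25 * a ≤ (k : ℝ) * h := by nlinarith [mul_nonneg (sub_nonneg.2 hk3') hh0.le]
    have hHpos : 0 < (k : ℝ) * h := mul_pos (by linarith) hh0
    have hsign := (hmono ((k : ℝ) * h) ((k : ℝ) * h) hH le_rfl).1
    have h1 := ljd_negD_le ha0 hHpos.ne'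
    have h2 := ljd_scale ha0 ((k : ℝ) * h)
    have h3 := ljd_Fk_le k hk3 hc0
    rw [ljd_barlowCoupling_eq, abs_of_nonpos hsign]
    refine mul_le_mul_of_nonneg_left ?_ (by linarith)
    rw [h2, hca k] at h1
    have ha6' : 0 ≤ (a ^ 6)⁻¹ := by positivity
    calc -barlowCoupling lennardJones a ((k : ℝ) * h) 1
        ≤ 1 / 12 * ((a ^ 6)⁻¹ * ∫ u in Ioi (0 : ℝ), (layerInteraction (fun r => Real.exp (-u * r ^ 2)) 1 0 0 0 -
            layerInteraction (fun r => Real.exp (-u * r ^ 2)) 1 0 1 0) * u ^ 2 *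
            Real.exp (-(u * ((k : ℝ) * c) ^ 2))) := h1
      _ ≤ 1 / 12 * ((a ^ 6)⁻¹ * (CF * ρ ^ k)) :=
          mul_le_mul_of_nonneg_left (mul_le_mul_of_nonneg_left h3 ha6') (by norm_num)
      _ = CF / (12 * a ^ 6) * ρ ^ k := by
          field_simp
  -- the dominating series `g k = (k - 1) (C_F/(12 a⁶)) ρ^k 1[k ≥ 3]` and its sum
  set g : ℕ → ℝ := fun k => if 3 ≤ k then ((k : ℝ) - 1) * (CF / (12 * a ^ 6) * ρ ^ k) else 0 with hg
  have hgsum : HasSum g (CF / (12 * a ^ 6) * (ρ ^ 3 * (ρ / (1 - ρ) ^ 2 + 2 / (1 - ρ)))) := by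
    have hρn : ‖ρ‖ < 1 := by rw [hρ, Real.norm_of_nonneg (by norm_num)]; norm_num
    have hA := hasSum_coe_mul_geometric_of_norm_lt_one hρn
    have hB := hasSum_geometric_of_lt_one (by rw [hρ]; norm_num) (by rw [hρ]; norm_num : ρ < 1)
    have hC : HasSum (fun n : ℕ => g (n + 3)) (CF / (12 * a ^ 6) * (ρ ^ 3 * (ρ / (1 - ρ) ^ 2 + 2 / (1 - ρ)))) := by
      have h := (hA.add (hB.mul_left 2)).mul_left (CF / (12 * a ^ 6) * ρ ^ 3)
      have hfun : (fun n : ℕ => g (n + 3)) =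
          fun i : ℕ => CF / (12 * a ^ 6) * ρ ^ 3 * ((i : ℝ) * ρ ^ i + 2 * ρ ^ i) := by
        funext n
        simp only [hg, if_pos (Nat.le_add_left 3 n)]
        push_cast
        ring
      have hval : CF / (12 * a ^ 6) * (ρ ^ 3 * (ρ / (1 - ρ) ^ 2 + 2 / (1 - ρ))) =
          CF / (12 * a ^ 6) * ρ ^ 3 * (ρ / (1 - ρ) ^ 2 + 2 * (1 - ρ)⁻¹) := by ring
      rw [hfun, hval]
      exact h
    have h0 : ∑ i ∈ Finset.range 3, g i = 0 := by
      simp [hg, Finset.sum_range_succ]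
    have h := (hasSum_nat_add_iff (f := g) 3).1 hC
    rwa [h0, add_zero] at h
  have hfg : ∀ k : ℕ, (if 3 ≤ k then ((k : ℝ) - 1) * |barlowCoupling lennardJones a h k| else 0) ≤ g k := by
    intro k
    simp only [hg]
    split_ifs with h3
    · exact hk k h3
    · exact le_rfl
  have hf0 : ∀ k : ℕ, 0 ≤ (if 3 ≤ k then ((k : ℝ) - 1) * |barlowCoupling lennardJones a h k| else 0) := by
    intro k
    split_ifs with h3
    · have : (3 : ℝ) ≤ k := by exact_mod_cast h3
      exact mul_nonneg (by linarith) (abs_nonneg _)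
    · exact le_rfl
  have hfs : Summable (fun k : ℕ => if 3 ≤ k then ((k : ℝ) - 1) * |barlowCoupling lennardJones a h k| else 0) :=
    hgsum.summable.of_nonneg_of_le hf0 hfg
  have key : CF * (ρ ^ 3 * (ρ / (1 - ρ) ^ 2 + 2 / (1 - ρ))) ≤ 1 / 2 * R := by
    rw [hCF, hρ, hR]
    norm_num
  calc ∑' k : ℕ, (if 3 ≤ k then ((k : ℝ) - 1) * |barlowCoupling lennardJones a h k| else 0)
      ≤ ∑' k, g k := Summable.tsum_le_tsum hfg hfs hgsum.summable
    _ = CF / (12 * a ^ 6) * (ρ ^ 3 * (ρ / (1 - ρ) ^ 2 + 2 / (1 - ρ))) := hgsum.tsum_eq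
    _ = CF * (ρ ^ 3 * (ρ / (1 - ρ) ^ 2 + 2 / (1 - ρ))) / (12 * a ^ 6) := by ring
    _ ≤ 1 / 2 * R / (12 * a ^ 6) := div_le_div_of_nonneg_right key ha6.le
    _ = 1 / 2 * (R / (12 * a ^ 6)) := by ring
    _ ≤ (1 / 2) * |barlowCoupling lennardJones a h 2| := by linarith [hJ2]

end Summit.AtomisticToContinuum.Crystallization.Theorems.PricedHcpWindowsLjDomination
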